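import Summits.CriticalPhenomena.PercolationContinuityZ3.Theorems.Transplant.SkelFrmBChoiceReadNums3
import Summits.CriticalPhenomena.PercolationContinuityZ3.Theorems.Transplant.SkelFrmBChoiceReadings
import Summits.CriticalPhenomena.PercolationContinuityZ3.Theorems.Transplant.SkelPhiNegReachReadCK
import HarnessLib

/-!
# N2 (frames-only node `SamePDropOfSkeletonFrm₁`, OPEN) — (ζ″) ledger under J23/(R-44): THE PRISM BOX AND ITS READING ROWS AT THE WIDER WINDOWS
# (`q := kgq qxQ4 = 98·n_L`, `W := kgW WxQ4 = 20·sL + 42`; `BSlot.small3 = (76·s₀, 19·s₁)`) — successor of SkelFrmBChoiceReadings (p356900): the prism box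
# `[prismLoQ3, prismHiQ3] = [(−Z₀, −Z₁), ((N+1)n + Z₀, Z₁)]`, its three budgets (`Z₀ ≤ 324n`, `Z₁ ≤ 29sL`: `357·Δn`, `(20K+38)·Δn`, `32·Δ`), and the rows
# **`hPl_Q3`** (`−5r₀ + 1 ≤ rdLo₀`, `rdHi₀ ≤ 22r₀ − 1`; now under `hKq : 5 ≤ Kq`, the small3 rows' K-floor) and **`hPt_Q3`** (`−2r₁ + 1 ≤ rdLo₁`, `rdHi₁ ≤ 2r₁ − 1`);
# `hsc_Q` (commensurability) is imported from the landed file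

* `prismLoQ3/prismHiQ3`, `prism_budgets3`, `hPl_Q3`, `hPt_Q3`.
NON-VACUITY: value rows at the closed tuple.
builds on p205010 (kernel theorem, internal audit signed; external expert review pending) — nothing in this file uses p205010; NOTHING is claimed about the open
node `SamePDropOfSkeletonFrm₁`.
Lane `prim-bschramm`, seat `prim-bschramm-stmt` (gen 21); helper file (`--supports stmt-CriticalPhenomena-4575 --as helper`).
[cite: KozmaNitzan2024, §4 Lemma 12 (pp. 23–25: the corridor's boxes)] [cite: MartineauTassion2017, §4.3 Lemma 4.2]
-/

open scoped Classical

noncomputable section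

namespace Summit.CriticalPhenomena.PercolationContinuityZ3.Theorems.Transplant

namespace PlanarSkeletonFrm

namespace NegB

open Literature.Probability.Percolation Literature.Probability.LatticeModels SimpleGraph
open SkelConc (Consts)
open Skelφ (shearUnit kgSL kgZ₀ kgZ₁ kgM₁ kgM₂ kgWm₂ kgWp₂ rdLo rdHi KGRows)
open TwoAxis.Para (modulus)
open Neg

section Read

variable (κ : Consts) {V : Type} [DecidableEq V] [Countable V] {G : SimpleGraph V} [G.LocallyFinite] (Φ : PlanarSkeletonFrm G) (t : V) (p : unitInterval)
  (D : Skelφ.StepI.DataNS V) (g f mk : ℕ)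

/-- Shorthand: the prism box's lower corner at the wider windows. [this work] -/
def prismLoQ3 : Site 2 :=
  ![-kgZ₀ (nL κ Φ t p D g f) (vL κ Φ t p D g f) (kgR κ Φ t p D mk) 0 (kgq κ Φ t p D g f (qxQ4 κ Φ t p D g f))
      (kgNv0 κ Φ t p D g f mk (qxQ4 κ Φ t p D g f) (WxQ4 κ Φ t p D g f))
      (kgM₁ (nL κ Φ t p D g f) (ℓL κ Φ t p D g f) (hL κ Φ t p D g f) (kgR κ Φ t p D mk) 0 (kgW κ Φ t p D g f (WxQ4 κ Φ t p D g f))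
        (kgNv0 κ Φ t p D g f mk (qxQ4 κ Φ t p D g f) (WxQ4 κ Φ t p D g f)))
      (kgM₂ (nL κ Φ t p D g f) (ℓL κ Φ t p D g f) (hL κ Φ t p D g f) (vL κ Φ t p D g f) (kgR κ Φ t p D mk) 0
        (kgq κ Φ t p D g f (qxQ4 κ Φ t p D g f)) (kgW κ Φ t p D g f (WxQ4 κ Φ t p D g f)) (kgNv0 κ Φ t p D g f mk (qxQ4 κ Φ t p D g f) (WxQ4 κ Φ t p D g f))),
    -kgZ₁ (nL κ Φ t p D g f) (ℓL κ Φ t p D g f) (hL κ Φ t p D g f) (kgR κ Φ t p D mk) 0 (kgW κ Φ t p D g f (WxQ4 κ Φ t p D g f))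
      (kgNv0 κ Φ t p D g f mk (qxQ4 κ Φ t p D g f) (WxQ4 κ Φ t p D g f))
      (kgM₁ (nL κ Φ t p D g f) (ℓL κ Φ t p D g f) (hL κ Φ t p D g f) (kgR κ Φ t p D mk) 0 (kgW κ Φ t p D g f (WxQ4 κ Φ t p D g f))
        (kgNv0 κ Φ t p D g f mk (qxQ4 κ Φ t p D g f) (WxQ4 κ Φ t p D g f)))
      (kgWm₂ (nL κ Φ t p D g f) (ℓL κ Φ t p D g f) (hL κ Φ t p D g f) (kgR κ Φ t p D mk) 0 (kgW κ Φ t p D g f (WxQ4 κ Φ t p D g f))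
        (kgNv0 κ Φ t p D g f mk (qxQ4 κ Φ t p D g f) (WxQ4 κ Φ t p D g f)))
      (kgWp₂ (nL κ Φ t p D g f) (ℓL κ Φ t p D g f) (hL κ Φ t p D g f) (kgR κ Φ t p D mk) 0 (kgW κ Φ t p D g f (WxQ4 κ Φ t p D g f))
        (kgNv0 κ Φ t p D g f mk (qxQ4 κ Φ t p D g f) (WxQ4 κ Φ t p D g f)))
      (kgM₂ (nL κ Φ t p D g f) (ℓL κ Φ t p D g f) (hL κ Φ t p D g f) (vL κ Φ t p D g f) (kgR κ Φ t p D mk) 0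
        (kgq κ Φ t p D g f (qxQ4 κ Φ t p D g f)) (kgW κ Φ t p D g f (WxQ4 κ Φ t p D g f)) (kgNv0 κ Φ t p D g f mk (qxQ4 κ Φ t p D g f) (WxQ4 κ Φ t p D g f)))]

/-- see `prismLoQ3`: the upper corner `((N+1)n_L + Z₀, Z₁)`. [this work] -/
def prismHiQ3 : Site 2 :=
  ![(((kgNv0 κ Φ t p D g f mk (qxQ4 κ Φ t p D g f) (WxQ4 κ Φ t p D g f) : ℕ) : ℤ) + 1) * (nL κ Φ t p D g f : ℤ) +
      kgZ₀ (nL κ Φ t p D g f) (vL κ Φ t p D g f) (kgR κ Φ t p D mk) 0 (kgq κ Φ t p D g f (qxQ4 κ Φ t p D g f))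
      (kgNv0 κ Φ t p D g f mk (qxQ4 κ Φ t p D g f) (WxQ4 κ Φ t p D g f))
      (kgM₁ (nL κ Φ t p D g f) (ℓL κ Φ t p D g f) (hL κ Φ t p D g f) (kgR κ Φ t p D mk) 0 (kgW κ Φ t p D g f (WxQ4 κ Φ t p D g f))
        (kgNv0 κ Φ t p D g f mk (qxQ4 κ Φ t p D g f) (WxQ4 κ Φ t p D g f)))
      (kgM₂ (nL κ Φ t p D g f) (ℓL κ Φ t p D g f) (hL κ Φ t p D g f) (vL κ Φ t p D g f) (kgR κ Φ t p D mk) 0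
        (kgq κ Φ t p D g f (qxQ4 κ Φ t p D g f)) (kgW κ Φ t p D g f (WxQ4 κ Φ t p D g f)) (kgNv0 κ Φ t p D g f mk (qxQ4 κ Φ t p D g f) (WxQ4 κ Φ t p D g f))),
    kgZ₁ (nL κ Φ t p D g f) (ℓL κ Φ t p D g f) (hL κ Φ t p D g f) (kgR κ Φ t p D mk) 0 (kgW κ Φ t p D g f (WxQ4 κ Φ t p D g f))
      (kgNv0 κ Φ t p D g f mk (qxQ4 κ Φ t p D g f) (WxQ4 κ Φ t p D g f))
      (kgM₁ (nL κ Φ t p D g f) (ℓL κ Φ t p D g f) (hL κ Φ t p D g f) (kgR κ Φ t p D mk) 0 (kgW κ Φ t p D g f (WxQ4 κ Φ t p D g f))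
        (kgNv0 κ Φ t p D g f mk (qxQ4 κ Φ t p D g f) (WxQ4 κ Φ t p D g f)))
      (kgWm₂ (nL κ Φ t p D g f) (ℓL κ Φ t p D g f) (hL κ Φ t p D g f) (kgR κ Φ t p D mk) 0 (kgW κ Φ t p D g f (WxQ4 κ Φ t p D g f))
        (kgNv0 κ Φ t p D g f mk (qxQ4 κ Φ t p D g f) (WxQ4 κ Φ t p D g f)))
      (kgWp₂ (nL κ Φ t p D g f) (ℓL κ Φ t p D g f) (hL κ Φ t p D g f) (kgR κ Φ t p D mk) 0 (kgW κ Φ t p D g f (WxQ4 κ Φ t p D g f))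
        (kgNv0 κ Φ t p D g f mk (qxQ4 κ Φ t p D g f) (WxQ4 κ Φ t p D g f)))
      (kgM₂ (nL κ Φ t p D g f) (ℓL κ Φ t p D g f) (hL κ Φ t p D g f) (vL κ Φ t p D g f) (kgR κ Φ t p D mk) 0
        (kgq κ Φ t p D g f (qxQ4 κ Φ t p D g f)) (kgW κ Φ t p D g f (WxQ4 κ Φ t p D g f)) (kgNv0 κ Φ t p D g f mk (qxQ4 κ Φ t p D g f) (WxQ4 κ Φ t p D g f)))]

/-- **THE THREE BUDGETS** of the prism box at the tuple of record: `0 ≤ Z₁`, (axis 0, lower) `Δ·Z₀ + |v|·U·(Z₁+1) + 3Δn ≤ 357·Δ·n`, (axis 0, upper)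
`Δ·((N+1)n + Z₀) + |v|·U·(Z₁+1) + 3Δn ≤ (20K + 38)·Δ·n`, (axis 1) `U·(Z₁+1) + 2Δ ≤ 32·Δ`. [this work] -/
theorem prism_budgets3 (hN : EqNumL κ Φ t p D g f) (hg : gFloorKG κ Φ t p D mk ≤ g) (hg2 : 40 * Neg.K κ * KS0.R'0 κ Φ t p D mk ≤ g) :
    0 ≤ prismHiQ3 κ Φ t p D g f mk 1 ∧
    modulus (nL κ Φ t p D g f) (hL κ Φ t p D g f) (vL κ Φ t p D g f) (vβL κ Φ t p D g f) * (-(prismLoQ3 κ Φ t p D g f mk 0)) +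
        |vL κ Φ t p D g f| * (((shearUnit (nL κ Φ t p D g f) (hL κ Φ t p D g f) : ℕ) : ℤ) * (prismHiQ3 κ Φ t p D g f mk 1 + 1)) +
        3 * modulus (nL κ Φ t p D g f) (hL κ Φ t p D g f) (vL κ Φ t p D g f) (vβL κ Φ t p D g f) * (nL κ Φ t p D g f : ℤ) ≤
      357 * modulus (nL κ Φ t p D g f) (hL κ Φ t p D g f) (vL κ Φ t p D g f) (vβL κ Φ t p D g f) * (nL κ Φ t p D g f : ℤ) ∧
    modulus (nL κ Φ t p D g f) (hL κ Φ t p D g f) (vL κ Φ t p D g f) (vβL κ Φ t p D g f) * (prismHiQ3 κ Φ t p D g f mk 0) +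
        |vL κ Φ t p D g f| * (((shearUnit (nL κ Φ t p D g f) (hL κ Φ t p D g f) : ℕ) : ℤ) * (prismHiQ3 κ Φ t p D g f mk 1 + 1)) +
        3 * modulus (nL κ Φ t p D g f) (hL κ Φ t p D g f) (vL κ Φ t p D g f) (vβL κ Φ t p D g f) * (nL κ Φ t p D g f : ℤ) ≤
      (20 * (Neg.K κ : ℤ) + 38) * modulus (nL κ Φ t p D g f) (hL κ Φ t p D g f) (vL κ Φ t p D g f) (vβL κ Φ t p D g f) * (nL κ Φ t p D g f : ℤ) ∧
    (((shearUnit (nL κ Φ t p D g f) (hL κ Φ t p D g f) : ℕ) : ℤ) * (prismHiQ3 κ Φ t p D g f mk 1 + 1)) +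
        2 * modulus (nL κ Φ t p D g f) (hL κ Φ t p D g f) (vL κ Φ t p D g f) (vβL κ Φ t p D g f) ≤
      32 * modulus (nL κ Φ t p D g f) (hL κ Φ t p D g f) (vL κ Φ t p D g f) (vβL κ Φ t p D g f) := by
  obtain ⟨hZ₀, hfar⟩ := Z₀Q4_le κ Φ t p D g f mk hN hg hg2
  have hZ₁ := Z₁Q4_le κ Φ t p D g f mk hN hg hg2
  have hUs := UsL_le_modulus κ Φ t p D g f hN
  obtain ⟨-, -, hbig, -, hK, -⟩ := valsQ_floor κ Φ t p D g f mk hN hg hg2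
  obtain ⟨-, -, -, -, -, hm, -⟩ := hsc_Q κ Φ t p D g f hN
  have hv := hN.v_le
  have hva : (0 : ℤ) ≤ |vL κ Φ t p D g f| := abs_nonneg _
  have hU : (0 : ℤ) ≤ ((shearUnit (nL κ Φ t p D g f) (hL κ Φ t p D g f) : ℕ) : ℤ) := by positivity
  have hn0 : (0 : ℤ) ≤ (nL κ Φ t p D g f : ℤ) := by positivity
  have e0 : prismLoQ3 κ Φ t p D g f mk 0 = -kgZ₀ (nL κ Φ t p D g f) (vL κ Φ t p D g f) (kgR κ Φ t p D mk) 0 (kgq κ Φ t p D g f (qxQ4 κ Φ t p D g f))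
      (kgNv0 κ Φ t p D g f mk (qxQ4 κ Φ t p D g f) (WxQ4 κ Φ t p D g f))
      (kgM₁ (nL κ Φ t p D g f) (ℓL κ Φ t p D g f) (hL κ Φ t p D g f) (kgR κ Φ t p D mk) 0 (kgW κ Φ t p D g f (WxQ4 κ Φ t p D g f))
        (kgNv0 κ Φ t p D g f mk (qxQ4 κ Φ t p D g f) (WxQ4 κ Φ t p D g f)))
      (kgM₂ (nL κ Φ t p D g f) (ℓL κ Φ t p D g f) (hL κ Φ t p D g f) (vL κ Φ t p D g f) (kgR κ Φ t p D mk) 0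
        (kgq κ Φ t p D g f (qxQ4 κ Φ t p D g f)) (kgW κ Φ t p D g f (WxQ4 κ Φ t p D g f)) (kgNv0 κ Φ t p D g f mk (qxQ4 κ Φ t p D g f) (WxQ4 κ Φ t p D g f))) := rfl
  have e1h : prismHiQ3 κ Φ t p D g f mk 0 = (((kgNv0 κ Φ t p D g f mk (qxQ4 κ Φ t p D g f) (WxQ4 κ Φ t p D g f) : ℕ) : ℤ) + 1) * (nL κ Φ t p D g f : ℤ) +
      kgZ₀ (nL κ Φ t p D g f) (vL κ Φ t p D g f) (kgR κ Φ t p D mk) 0 (kgq κ Φ t p D g f (qxQ4 κ Φ t p D g f))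
      (kgNv0 κ Φ t p D g f mk (qxQ4 κ Φ t p D g f) (WxQ4 κ Φ t p D g f))
      (kgM₁ (nL κ Φ t p D g f) (ℓL κ Φ t p D g f) (hL κ Φ t p D g f) (kgR κ Φ t p D mk) 0 (kgW κ Φ t p D g f (WxQ4 κ Φ t p D g f))
        (kgNv0 κ Φ t p D g f mk (qxQ4 κ Φ t p D g f) (WxQ4 κ Φ t p D g f)))
      (kgM₂ (nL κ Φ t p D g f) (ℓL κ Φ t p D g f) (hL κ Φ t p D g f) (vL κ Φ t p D g f) (kgR κ Φ t p D mk) 0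
        (kgq κ Φ t p D g f (qxQ4 κ Φ t p D g f)) (kgW κ Φ t p D g f (WxQ4 κ Φ t p D g f)) (kgNv0 κ Φ t p D g f mk (qxQ4 κ Φ t p D g f) (WxQ4 κ Φ t p D g f))) := rfl
  have e1 : prismHiQ3 κ Φ t p D g f mk 1 = kgZ₁ (nL κ Φ t p D g f) (ℓL κ Φ t p D g f) (hL κ Φ t p D g f) (kgR κ Φ t p D mk) 0 (kgW κ Φ t p D g f (WxQ4 κ Φ t p D g f))
      (kgNv0 κ Φ t p D g f mk (qxQ4 κ Φ t p D g f) (WxQ4 κ Φ t p D g f))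
      (kgM₁ (nL κ Φ t p D g f) (ℓL κ Φ t p D g f) (hL κ Φ t p D g f) (kgR κ Φ t p D mk) 0 (kgW κ Φ t p D g f (WxQ4 κ Φ t p D g f))
        (kgNv0 κ Φ t p D g f mk (qxQ4 κ Φ t p D g f) (WxQ4 κ Φ t p D g f)))
      (kgWm₂ (nL κ Φ t p D g f) (ℓL κ Φ t p D g f) (hL κ Φ t p D g f) (kgR κ Φ t p D mk) 0 (kgW κ Φ t p D g f (WxQ4 κ Φ t p D g f))
        (kgNv0 κ Φ t p D g f mk (qxQ4 κ Φ t p D g f) (WxQ4 κ Φ t p D g f)))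
      (kgWp₂ (nL κ Φ t p D g f) (ℓL κ Φ t p D g f) (hL κ Φ t p D g f) (kgR κ Φ t p D mk) 0 (kgW κ Φ t p D g f (WxQ4 κ Φ t p D g f))
        (kgNv0 κ Φ t p D g f mk (qxQ4 κ Φ t p D g f) (WxQ4 κ Φ t p D g f)))
      (kgM₂ (nL κ Φ t p D g f) (ℓL κ Φ t p D g f) (hL κ Φ t p D g f) (vL κ Φ t p D g f) (kgR κ Φ t p D mk) 0
        (kgq κ Φ t p D g f (qxQ4 κ Φ t p D g f)) (kgW κ Φ t p D g f (WxQ4 κ Φ t p D g f)) (kgNv0 κ Φ t p D g f mk (qxQ4 κ Φ t p D g f) (WxQ4 κ Φ t p D g f))) := rfl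
  have hZ₁0 : 0 ≤ prismHiQ3 κ Φ t p D g f mk 1 := by rw [e1]; unfold Skelφ.kgZ₁; positivity
  rw [e0, e1h, neg_neg]
  rw [e1] at hZ₁0 ⊢
  set Δ := modulus (nL κ Φ t p D g f) (hL κ Φ t p D g f) (vL κ Φ t p D g f) (vβL κ Φ t p D g f) with hΔ
  set U := ((shearUnit (nL κ Φ t p D g f) (hL κ Φ t p D g f) : ℕ) : ℤ) with hUdef
  set s := kgSL (nL κ Φ t p D g f) (ℓL κ Φ t p D g f) (hL κ Φ t p D g f) with hsdef
  set n := (nL κ Φ t p D g f : ℤ) with hndef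
  set Z₁ := kgZ₁ (nL κ Φ t p D g f) (ℓL κ Φ t p D g f) (hL κ Φ t p D g f) (kgR κ Φ t p D mk) 0 (kgW κ Φ t p D g f (WxQ4 κ Φ t p D g f))
      (kgNv0 κ Φ t p D g f mk (qxQ4 κ Φ t p D g f) (WxQ4 κ Φ t p D g f))
      (kgM₁ (nL κ Φ t p D g f) (ℓL κ Φ t p D g f) (hL κ Φ t p D g f) (kgR κ Φ t p D mk) 0 (kgW κ Φ t p D g f (WxQ4 κ Φ t p D g f))
        (kgNv0 κ Φ t p D g f mk (qxQ4 κ Φ t p D g f) (WxQ4 κ Φ t p D g f)))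
      (kgWm₂ (nL κ Φ t p D g f) (ℓL κ Φ t p D g f) (hL κ Φ t p D g f) (kgR κ Φ t p D mk) 0 (kgW κ Φ t p D g f (WxQ4 κ Φ t p D g f))
        (kgNv0 κ Φ t p D g f mk (qxQ4 κ Φ t p D g f) (WxQ4 κ Φ t p D g f)))
      (kgWp₂ (nL κ Φ t p D g f) (ℓL κ Φ t p D g f) (hL κ Φ t p D g f) (kgR κ Φ t p D mk) 0 (kgW κ Φ t p D g f (WxQ4 κ Φ t p D g f))
        (kgNv0 κ Φ t p D g f mk (qxQ4 κ Φ t p D g f) (WxQ4 κ Φ t p D g f)))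
      (kgM₂ (nL κ Φ t p D g f) (ℓL κ Φ t p D g f) (hL κ Φ t p D g f) (vL κ Φ t p D g f) (kgR κ Φ t p D mk) 0
        (kgq κ Φ t p D g f (qxQ4 κ Φ t p D g f)) (kgW κ Φ t p D g f (WxQ4 κ Φ t p D g f)) (kgNv0 κ Φ t p D g f mk (qxQ4 κ Φ t p D g f) (WxQ4 κ Φ t p D g f)))
    with hZ₁def
  -- U (Z₁ + 1) ≤ 30 U s ≤ 30 Δ
  have hUZ : U * (Z₁ + 1) ≤ 30 * Δ := by
    have h1 : U * (Z₁ + 1) ≤ U * (30 * s) := mul_le_mul_of_nonneg_left (by linarith) hU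
    nlinarith
  have hvUZ : |vL κ Φ t p D g f| * (U * (Z₁ + 1)) ≤ n * (30 * Δ) := by
    have hUZ0 : 0 ≤ U * (Z₁ + 1) := by positivity
    calc |vL κ Φ t p D g f| * (U * (Z₁ + 1)) ≤ n * (U * (Z₁ + 1)) := mul_le_mul_of_nonneg_right hv hUZ0
      _ ≤ n * (30 * Δ) := mul_le_mul_of_nonneg_left hUZ hn0
  refine ⟨hZ₁0, ?_, ?_, by linarith⟩
  · have := mul_le_mul_of_nonneg_left hZ₀ hm.le
    nlinarith
  · have := mul_le_mul_of_nonneg_left hfar hm.le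
    nlinarith

/-- **THE PRISM READING ROWS, ALONG (axis 0)**: `−5r₀ + 1 ≤ rdLo₀` and `rdHi₀ ≤ 22r₀ − 1` for the prism box at the tuple of record (p5's `hPl` at
`du.1 = 0`). [this work] -/
theorem hPl_Q3 (hKq : 5 ≤ Neg.Kq κ) (hN : EqNumL κ Φ t p D g f) (hg : gFloorKG κ Φ t p D mk ≤ g) (hg2 : 40 * Neg.K κ * KS0.R'0 κ Φ t p D mk ≤ g) :
    -(5 * (((fcellsA κ Φ t p D g f).r 0 : ℕ) : ℤ)) + 1 ≤
        rdLo (Aof κ) (nL κ Φ t p D g f) (hL κ Φ t p D g f) (vL κ Φ t p D g f) (vβL κ Φ t p D g f) (prFA κ Φ t p D g f).c₀ (prFA κ Φ t p D g f).c₁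
          (prFA κ Φ t p D g f).D (prismLoQ3 κ Φ t p D g f mk) (prismHiQ3 κ Φ t p D g f mk) 0 ∧
      rdHi (Aof κ) (nL κ Φ t p D g f) (hL κ Φ t p D g f) (vL κ Φ t p D g f) (vβL κ Φ t p D g f) (prFA κ Φ t p D g f).c₀ (prFA κ Φ t p D g f).c₁
          (prFA κ Φ t p D g f).D (prismLoQ3 κ Φ t p D g f mk) (prismHiQ3 κ Φ t p D g f mk) 0 ≤ 22 * (((fcellsA κ Φ t p D g f).r 0 : ℕ) : ℤ) - 1 := by
  obtain ⟨hsc0, -, hn1, hA0, hDp, hm, hc₀, -, hkq, hr40⟩ := hsc_Q κ Φ t p D g f hN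
  obtain ⟨hZ₁0, hb1, hb2, -⟩ := prism_budgets3 κ Φ t p D g f mk hN hg hg2
  obtain ⟨-, -, -, -, hK, -⟩ := valsQ_floor κ Φ t p D g f mk hN hg hg2
  have hn0 : (0 : ℤ) ≤ (nL κ Φ t p D g f : ℤ) := by positivity
  have hl1 : |prismLoQ3 κ Φ t p D g f mk 1| ≤ prismHiQ3 κ Φ t p D g f mk 1 := by
    have : prismLoQ3 κ Φ t p D g f mk 1 = -prismHiQ3 κ Φ t p D g f mk 1 := rfl
    rw [this, abs_neg, abs_of_nonneg hZ₁0]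
  have hh1 : |prismHiQ3 κ Φ t p D g f mk 1| ≤ prismHiQ3 κ Φ t p D g f mk 1 := by rw [abs_of_nonneg hZ₁0]
  have hΔn : 0 ≤ modulus (nL κ Φ t p D g f) (hL κ Φ t p D g f) (vL κ Φ t p D g f) (vβL κ Φ t p D g f) * (nL κ Φ t p D g f : ℤ) :=
    mul_nonneg hm.le hn0
  have hkq' : (1 : ℤ) ≤ ((Neg.Kq κ : ℕ) : ℤ) := by exact_mod_cast hkq
  have hKq40 : (Neg.K κ : ℤ) = 40 * ((Neg.Kq κ : ℕ) : ℤ) := by exact_mod_cast Neg.K_eq κ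
  constructor
  · refine Skelφ.readLo0_of_budgetK (hn := hn1) (hA := hA0) (hD := hDp) (hm := hm) (hc₀ := hc₀) (hkq := hkq) (hsc0 := hsc0) (hr40 := hr40)
      (B := -(prismLoQ3 κ Φ t p D g f mk 0)) (X₁ := prismHiQ3 κ Φ t p D g f mk 1) (m := 5) (by simp) hl1 hh1 ?_
    have hkq5 : (5 : ℤ) ≤ ((Neg.Kq κ : ℕ) : ℤ) := by exact_mod_cast hKq
    have h78 := mul_le_mul_of_nonneg_right (show (357 : ℤ) ≤ 40 * ((Neg.Kq κ : ℕ) : ℤ) * 5 by linarith) hΔn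
    nlinarith
  · refine Skelφ.readHi0_of_budgetK (hn := hn1) (hD := hDp) (hm := hm) (hc₀ := hc₀) (hkq := hkq) (hsc0 := hsc0) (hr40 := hr40)
      (B := prismHiQ3 κ Φ t p D g f mk 0) (X₁ := prismHiQ3 κ Φ t p D g f mk 1) (m := 22) le_rfl hl1 hh1 ?_
    have h22 := mul_le_mul_of_nonneg_right (show (20 * (Neg.K κ : ℤ) + 38) ≤ 40 * ((Neg.Kq κ : ℕ) : ℤ) * 22 by rw [hKq40] at hK ⊢; linarith) hΔn
    nlinarith

/-- **THE PRISM READING ROWS, ACROSS (axis 1)**: `−2r₁ + 1 ≤ rdLo₁` and `rdHi₁ ≤ 2r₁ − 1` (p5's `hPt` at `du.1 = 0`). [this work] -/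
theorem hPt_Q3 (hN : EqNumL κ Φ t p D g f) (hg : gFloorKG κ Φ t p D mk ≤ g) (hg2 : 40 * Neg.K κ * KS0.R'0 κ Φ t p D mk ≤ g) :
    -(2 * (((fcellsA κ Φ t p D g f).r 1 : ℕ) : ℤ)) + 1 ≤
        rdLo (Aof κ) (nL κ Φ t p D g f) (hL κ Φ t p D g f) (vL κ Φ t p D g f) (vβL κ Φ t p D g f) (prFA κ Φ t p D g f).c₀ (prFA κ Φ t p D g f).c₁
          (prFA κ Φ t p D g f).D (prismLoQ3 κ Φ t p D g f mk) (prismHiQ3 κ Φ t p D g f mk) 1 ∧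
      rdHi (Aof κ) (nL κ Φ t p D g f) (hL κ Φ t p D g f) (vL κ Φ t p D g f) (vβL κ Φ t p D g f) (prFA κ Φ t p D g f).c₀ (prFA κ Φ t p D g f).c₁
          (prFA κ Φ t p D g f).D (prismLoQ3 κ Φ t p D g f mk) (prismHiQ3 κ Φ t p D g f mk) 1 ≤ 2 * (((fcellsA κ Φ t p D g f).r 1 : ℕ) : ℤ) - 1 := by
  obtain ⟨-, hsc1, hn1, hA0, hDp, hm, -, -, hkq, hr40⟩ := hsc_Q κ Φ t p D g f hN
  obtain ⟨hZ₁0, -, -, hb3⟩ := prism_budgets3 κ Φ t p D g f mk hN hg hg2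
  obtain ⟨-, -, -, -, hK, -⟩ := valsQ_floor κ Φ t p D g f mk hN hg hg2
  have hKq40 : (Neg.K κ : ℤ) = 40 * ((Neg.Kq κ : ℕ) : ℤ) := by exact_mod_cast Neg.K_eq κ
  have hU : (0 : ℤ) ≤ ((shearUnit (nL κ Φ t p D g f) (hL κ Φ t p D g f) : ℕ) : ℤ) := by positivity
  have hlo1 : prismLoQ3 κ Φ t p D g f mk 1 = -prismHiQ3 κ Φ t p D g f mk 1 := rfl
  have hkq' : (1 : ℤ) ≤ ((Neg.Kq κ : ℕ) : ℤ) := by exact_mod_cast hkq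
  have h17 := mul_le_mul_of_nonneg_right (show (32 : ℤ) ≤ 40 * ((Neg.Kq κ : ℕ) : ℤ) * 2 by linarith) hm.le
  constructor
  · refine Skelφ.readLo1_of_budgetK (hD := hDp) (hm := hm) (hkq := hkq) (hsc1 := hsc1) (hr40 := hr40)
      (B := prismHiQ3 κ Φ t p D g f mk 1) (m := 2) (by rw [hlo1]) ?_
    have : ((shearUnit (nL κ Φ t p D g f) (hL κ Φ t p D g f) : ℕ) : ℤ) * prismHiQ3 κ Φ t p D g f mk 1 ≤
        ((shearUnit (nL κ Φ t p D g f) (hL κ Φ t p D g f) : ℕ) : ℤ) * (prismHiQ3 κ Φ t p D g f mk 1 + 1) := by nlinarith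
    nlinarith
  · refine Skelφ.readHi1_of_budgetK (hD := hDp) (hm := hm) (hkq := hkq) (hsc1 := hsc1) (hr40 := hr40)
      (B := prismHiQ3 κ Φ t p D g f mk 1) (m := 2) le_rfl ?_
    nlinarith

end Read

end NegB

end PlanarSkeletonFrm

end Summit.CriticalPhenomena.PercolationContinuityZ3.Theorems.Transplant

end
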